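/-
Copyright (c) 2026 the pub-hodgecm-mathlib formalisation cell (harness21).  Prover seat hodgecm-mathlib-R90-C133-p02 (g0), Track B ∕ R90-TF, h413 = `stmt-HodgeConjecture-24833`,
R90-TF section S8 «ContSpec-n½» (deal S8-R27 (2) H5 2026-09-04T22:06:59Z, letter shape rule S8-R29 (2)): the (N_blk) letter `hN` of ★ LAYER 2 PRINT p862113
`R90S8ResHLeClosureCharLinesOfLetters` — «an irreducible of `L²_res` carries NO LINE MASS» — paid from the E1 estate's ★ D5′ («an irreducible summand has no continuous spectrum at the
block»), hypothesis-first on D5′'s model letters and on ONE interface property of the line space `Ln`.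
-/
import Summits.HodgeConjecture.HodgeConjecture.Theorems.K2E1IrreducibleNoContinuousSpectrumCMTwoOfLetters   -- ★ p860487 D5′ at `U(H)(𝔸_{L⁺})`: `lpModel_blockProj_eq_zero_of_irreducible_subrep_cm`; brings ★ `K2E1HeckeAlgebraLettersCM` (block-projector letters)
import Summits.HodgeConjecture.HodgeConjecture.Theorems.K2E1CuspidalSpectrumUnitaryDefs                      -- ★ `residualSubspace 𝒢 μ 𝔓 = L²_disc ⊓ (L²_cusp)ᗮ`
import Literature.NumberTheory.Automorphic.UnitaryGroupAutomorphicRep                                         -- ★ Mok's `quasiSplit L⁺ L c N = adelicGroupData L⁺ L c N ((antidiagonal N).over L)`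
import Summits.HodgeConjecture.HodgeConjecture.Theorems.R90S8ResHBlockDataU2Defs                           -- ★ p862464 (K2E1-p15, H4″ DEFS): `resHBlock ∕ resHAtom ∕ resHLine`, `inner_eq_zero_of_mem_resHLine` (ED. 2)
import HarnessLib

/-!
# S8 #4′ road, letter (N_blk) — `R90S8ResHIsotypicVectorsAreResiduesU2`: the isotypic vectors of an irreducible closed subrepresentation of `L²(U(J₂)_{L∕L⁺})` are ORTHOGONAL TO THE
# LINE SPACE of every block, from ★ D5′, modulo D5′'s model letters and the line-space interface

Track B ∕ R90-TF, crux h413 = `stmt-HodgeConjecture-24833`, route of record `HCCMUnconditional`; cell `hodgecm-mathlib`, R90-TF programme, section S8 «ContSpec-n½», socket #4′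
`sock_S8_resH_spannedByCharLines` of `Lines/R90_S8_ResidualSpectrumU3B.lean`.  THEOREMS ONLY (no `def`, no `instance`, no `notation`, no named-fact hypothesis, no `sorry`; default
heartbeats); lane `--supports stmt-HodgeConjecture-24833 --as helper` (count-neutral).  CLOSES NO SOCKET and pays no socket: it supplies the (N_blk) binder `hN` of ★ p862113
`residual_le_topologicalClosure_iSup_charLines_of_letters` (tree `R90S8ResHLeClosureCharLinesOfLetters.lean` :90–92) at an ARBITRARY level datum `(K′, ω)` (S8-R29 (2)), for ANY line
space `Ln` satisfying the interface (N-iface) below — the defs of record `At ∕ Ln` (H4′, `R90S8ResHBlockDataU2Defs`) plug in by name.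

THE LETTER (bytes :90–92 of ★ p862113).  `hN : ∀ ℓ b W′, W′.IsTopIrreducible → W′ ≤ residualSubspace (quasiSplit L⁺ L c 2) μ 𝔓 → W′.toSubmodule ⊓ Iso(K′ ℓ, ω ℓ) ≤ (Ln ℓ b)ᗮ` with
`Iso(K′, ω) = ⨅ k : K′, eigenspace (R k) (ω k)`: an irreducible of `L²_res` has NO LINE MASS (D5′ shape; [MW95, IV.3.12 (b), VI.2; V.3.13]).  Since `residualSubspace = L²_disc ⊓ (L²_cusp)ᗮ`
and `L²_disc = discretePart` is the closed span of ALL irreducibles, the residual hypothesis is idle: the content is «lines ⟂ every irreducible».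

THE MATHEMATICS = ★ D5′ (E1, 5Res ENDGAME; ★ p860349 abstract, ★ p860487 at `U(H)(𝔸_{L⁺})`): on the `(τ,K′_f)`-block `V_P = {P v = v}` of the block projector `P = P_χ ∘L R_f(e)`, the
arch-central Hecke operators `T_j` act through the MODEL map `U` (the line coordinate of the block's Plancherel isometry) by their symbols `s_j`; on an irreducible `W` they act by scalars,
so `U(P w)` lives on a joint level set `⋂_j {s_j = c_j}`, which is Lebesgue-null on the unitary axis (hline) — hence **`U (P w) = 0`** for every `w ∈ W`.  If the line space `Ln` sits inside
`V_P` and is DETECTED BY THE LINE COORDINATE there — (N-iface) «`v ∈ Ln`, `P y = y`, `U y = 0` ⟹ `⟪v, y⟫ = 0`», automatic for `Ln :=` the pure-line vectors of the block model or the closed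
span of the unitary-axis wave packets adjoint to `U` — then for `y ∈ W`: `⟪v, y⟫ = ⟪P v, y⟫ = ⟪v, P y⟫ = 0` (`P` self-adjoint, `P y ∈ V_P`, D5′).  So `W ⟂ Ln`, a fortiori `W ⊓ Iso ⟂ Ln`.
* §1 **`subrep_le_orthogonal_of_lineModel_cm`** — every `N`, every `H`, ANY unitary strongly continuous `π` of `U(H)(𝔸_{L⁺}) = (cmDatum L N H).Adelic` on a Hilbert space `V` (E1: `R` on `L²`):
  D5′'s letters + (N-iface) ⊢ `W.toSubmodule ≤ Lnᗮ` for every irreducible closed `W ≤ V`.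
* §2 **`resH_isotypic_le_orthogonal_of_lineModel`** — THE (N_blk) CLAUSE at Mok's `quasiSplit L⁺ L c 2` (`π := R` on `L²(μ)`; `(quasiSplit L⁺ L c 2).Adelic = (cmDatum L 2 ((antidiagonal
  2).over L)).Adelic` definitionally), arbitrary `𝔓`, `(K′, ω)`, `Ln`: the bytes of `hN ℓ b` with `K′ ℓ ↦ K′`, `ω ℓ ↦ ω`, `Ln ℓ b ↦ Ln`.
* §3 (ED. 2) **`resH_isotypic_le_orthogonal_lines`** — THE (N_blk) CLAUSE BY NAME at the line space of record `Ln := resHLine L μ U′ K′ ω b` (★ p862464 H4″ DEFS), `U := snd ∘ U′`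
  for the block-model coordinate `U′ : L² →ₗ[ℂ] A × L²(Ω; E)`; (N-iface) discharged by ★ `inner_eq_zero_of_mem_resHLine` ∕ `resHLine_le_resHBlock`, leaving the two visible model
  letters `hScP : resHBlock ≤ V_P` and `hUker : resHBlockᗮ ≤ ker U′`.
VISIBLE LETTERS (the honest bill, = D5′'s D-road bill at this block): the block-projector data `(κ, μK, χ; e, K′_f)` with `hPdef`, (L1) `T, hT𝓐, hTP, hTB`, (L2) the model `U, s, hs, hU`,
(L3) `hline`; and (N-iface) `hLnP, hLnU` for the line space.  Nothing else; no statement of ★ p862113 is restated.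
HONEST LABEL: HC_CM is proved only modulo the 7 printed citations (2 remaining named inputs: hLiu418 = `stmt-HodgeConjecture-24832`, h413 = `stmt-HodgeConjecture-24833`) until
rung 0 closes; REL ≠ ★ ≠ BUILT; this file asserts no named fact, is conditional by construction on its visible binders, and closes no socket; count-neutral.

## References
* [MoeglinWaldspurger1995] C. Mœglin, J.-L. Waldspurger, *Spectral Decomposition and Eisenstein Series* (1995), I.2.18, IV.3.12 (b), V.3.13, VI.2.
* [DeitmarEchterhoff2014] A. Deitmar, S. Echterhoff, *Principles of Harmonic Analysis* (2014), Lemma 6.1.7, Prop. 6.2.1.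
* [ReedSimonI1980] M. Reed, B. Simon, *Methods of Modern Mathematical Physics I* (1980), Thm. II.3, Thm. VII.2.
-/

set_option autoImplicit false
set_option linter.dupNamespace false  -- the mandated namespace `…HodgeConjecture.HodgeConjecture.R90.S8` (LEAD #1 L1) repeats the summit's segment

noncomputable section

open MeasureTheory Filter Topology CompactlySupported NumberField ContRepresentation Set
open scoped InnerProductSpace ENNReal ComplexConjugate
open Literature.NumberTheory.Automorphic Literature.NumberTheory.Automorphic.UnitaryGroup AdelicGroupData
open Summit.HodgeConjecture.HodgeConjecture.Cruxes.H413.K2E1IrreducibleNoContinuousSpectrumCMTwoOfLetters (lpModel_blockProj_eq_zero_of_irreducible_subrep_cm)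
open Summit.HodgeConjecture.HodgeConjecture.Cruxes.H413.K2E1CuspidalSpectrumUnitary (residualSubspace)
open Summit.HodgeConjecture.HodgeConjecture.Cruxes.H413.K2E1HeckeAlgebraLettersCM

namespace Summit.HodgeConjecture.HodgeConjecture.R90.S8

/-! ## §1 Every `N`, every `H`: an irreducible closed subrepresentation of `L²(U(H))` is orthogonal to any line space detected by the D5′ line coordinate -/

section Generic

variable {L : Type} [Field L] [NumberField L] [IsCMField L] {N : ℕ} {H : Matrix (Fin N) (Fin N) L}
  {K V : Type*} [Group K] [TopologicalSpace K] [MeasurableSpace K] [BorelSpace K]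
  [NormedAddCommGroup V] [InnerProductSpace ℂ V] [CompleteSpace V]
  (π : ContRepresentation ℂ (cmDatum L N H).Adelic V) (hu : π.IsUnitary) (hc : π.IsStronglyContinuous)
  [MeasurableSpace (UnitaryGroup.arch (↥(maximalRealSubfield L)) L (IsCMField.complexConj L) N H)] [BorelSpace (UnitaryGroup.arch (↥(maximalRealSubfield L)) L (IsCMField.complexConj L) N H)]
  [MeasurableSpace (finAdelic (↥(maximalRealSubfield L)) L (IsCMField.complexConj L) N H)] [BorelSpace (finAdelic (↥(maximalRealSubfield L)) L (IsCMField.complexConj L) N H)]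
  (νinf : Measure (UnitaryGroup.arch (↥(maximalRealSubfield L)) L (IsCMField.complexConj L) N H)) [IsFiniteMeasureOnCompacts νinf] [νinf.IsMulLeftInvariant] [νinf.IsInvInvariant] [νinf.IsOpenPosMeasure]
  (νf : Measure (finAdelic (↥(maximalRealSubfield L)) L (IsCMField.complexConj L) N H)) [IsFiniteMeasureOnCompacts νf] [νf.IsMulLeftInvariant] [νf.IsInvInvariant] [νf.IsOpenPosMeasure]
  (κ : K →* UnitaryGroup.arch (↥(maximalRealSubfield L)) L (IsCMField.complexConj L) N H) (hκ : Continuous κ)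
  (μK : Measure K) [IsFiniteMeasureOnCompacts μK] [IsProbabilityMeasure μK] [MeasurableMul K] [μK.IsMulLeftInvariant] [MeasurableInv K] [μK.IsInvInvariant]
  (χ : C_c(K, ℂ)) (e : C_c(finAdelic (↥(maximalRealSubfield L)) L (IsCMField.complexConj L) N H, ℂ))
  {Ω : Type*} {mΩ : MeasurableSpace Ω} (m : Measure Ω) {E : Type*} [NormedAddCommGroup E] [NormedSpace ℂ E] {J : Type*} [Countable J]
variable [ENNReal.HolderTriple ∞ 2 2]

/-- **An irreducible closed summand of a unitary representation of `U(H)(𝔸_{L⁺})` is ORTHOGONAL to every line space detected by the D5′ line coordinate** (every `N`, every `H`; `π` ANY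
unitary strongly continuous representation on a Hilbert space `V` — E1: `R` on `L²`).  Data and letters of ★ D5′ `lpModel_blockProj_eq_zero_of_irreducible_subrep_cm` (block projector
`P = P_χ ∘L π_f(e)` via `hPdef`; (L1) Hecke operators `T, hT𝓐, hTP, hTB`; (L2) the model `U : V →ₗ[ℂ] L²(Ω; E)` with symbols `s, hs, hU` on `V_P = {P v = v}`; (L3) `hline`), and a line
space `Ln ≤ V` with (N-iface): `Ln ≤ V_P` (`hLnP`) and «`v ∈ Ln`, `y ∈ V_P`, `U y = 0` ⟹ `⟪v, y⟫ = 0`» (`hLnU`).  THEN `W ⟂ Ln` for every topologically irreducible closed `W ≤ V`: for `y ∈ W`,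
`v ∈ Ln`, `⟪v, y⟫ = ⟪P v, y⟫ = ⟪v, P y⟫` (★ `cm_blockProjector_hPsa`), `P y ∈ V_P` (★ `cm_blockProjector_hPV`) and `U (P y) = 0` (★ D5′).
[cite: MoeglinWaldspurger1995, IV.3.12, VI.2] [cite: DeitmarEchterhoff2014, Lemma 6.1.7] [cite: ReedSimonI1980, Thm. II.3] -/
theorem subrep_le_orthogonal_of_lineModel_cm
    (hχmul : ∀ k l, χ (k * l) = χ k * χ l) (hχone : χ 1 = 1) (hχinv : ∀ k, conj (χ k⁻¹) = χ k)
    (K' : Subgroup (finAdelic (↥(maximalRealSubfield L)) L (IsCMField.complexConj L) N H)) (he0 : ∀ x, x ∉ K' → e x = 0) (he1 : ∫ x, e x ∂νf = 1)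
    (heK : ∀ k ∈ K', ∀ x, e (k * x) = e x) (hestar : ∀ x, mulStar (⇑e) x = e x)
    (P : V →L[ℂ] V) (hPdef : P = ((π.restrict ((archToAdelic (↥(maximalRealSubfield L)) L (IsCMField.complexConj L) N H).comp κ)).integratedOperator (hu.restrict _)
          (hc.restrict _ ((continuous_archToAdelic (↥(maximalRealSubfield L)) L (IsCMField.complexConj L) N H).comp hκ)) μK χ ∘L
        (π.restrict (finAdelicToAdelic (↥(maximalRealSubfield L)) L (IsCMField.complexConj L) N H)).integratedOperator (hu.restrict _) (hc.restrict _ (continuous_finAdelicToAdelic (↥(maximalRealSubfield L)) L (IsCMField.complexConj L) N H)) νf e))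
    (T : J → V →L[ℂ] V) (hT𝓐 : ∀ j, T j ∈ {A : V →L[ℂ] V | ∃ (a : C_c(UnitaryGroup.arch (↥(maximalRealSubfield L)) L (IsCMField.complexConj L) N H, ℂ)) (b : C_c(finAdelic (↥(maximalRealSubfield L)) L (IsCMField.complexConj L) N H, ℂ)),
      A = (π.restrict (archToAdelic (↥(maximalRealSubfield L)) L (IsCMField.complexConj L) N H)).integratedOperator (hu.restrict _) (hc.restrict _ (continuous_archToAdelic (↥(maximalRealSubfield L)) L (IsCMField.complexConj L) N H)) νinf a ∘L
          (π.restrict (finAdelicToAdelic (↥(maximalRealSubfield L)) L (IsCMField.complexConj L) N H)).integratedOperator (hu.restrict _) (hc.restrict _ (continuous_finAdelicToAdelic (↥(maximalRealSubfield L)) L (IsCMField.complexConj L) N H)) νf b})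
    (hTP : ∀ j, Commute P (T j))
    (hTB : ∀ j, ∀ A ∈ {A : V →L[ℂ] V | ∃ (a : C_c(UnitaryGroup.arch (↥(maximalRealSubfield L)) L (IsCMField.complexConj L) N H, ℂ)) (b : C_c(finAdelic (↥(maximalRealSubfield L)) L (IsCMField.complexConj L) N H, ℂ)),
      A = (π.restrict (archToAdelic (↥(maximalRealSubfield L)) L (IsCMField.complexConj L) N H)).integratedOperator (hu.restrict _) (hc.restrict _ (continuous_archToAdelic (↥(maximalRealSubfield L)) L (IsCMField.complexConj L) N H)) νinf a ∘L
          (π.restrict (finAdelicToAdelic (↥(maximalRealSubfield L)) L (IsCMField.complexConj L) N H)).integratedOperator (hu.restrict _) (hc.restrict _ (continuous_finAdelicToAdelic (↥(maximalRealSubfield L)) L (IsCMField.complexConj L) N H)) νf b},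
      ∀ x ∈ LinearMap.eqLocus (P : V →ₗ[ℂ] V) LinearMap.id, P (A (T j x)) = T j (P (A x)))
    (U : V →ₗ[ℂ] Lp E 2 m) (s : J → Ω → ℂ) (hs : ∀ j, MemLp (s j) ∞ m)
    (hU : ∀ j, ∀ v ∈ LinearMap.eqLocus (P : V →ₗ[ℂ] V) LinearMap.id, U (T j v) = (hs j).toLp (s j) • U v)
    (hline : ∀ c : J → ℂ, m {x | ∀ j, s j x = c j} = 0)
    (Ln : Submodule ℂ V) (hLnP : ∀ v ∈ Ln, P v = v)
    (hLnU : ∀ v ∈ Ln, ∀ y ∈ LinearMap.eqLocus (P : V →ₗ[ℂ] V) LinearMap.id, U y = 0 → ⟪v, y⟫_ℂ = 0)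
    (W : ClosedSubrep π) (hW : W.toContRep.IsTopIrreducible) :
    W.toSubmodule ≤ Lnᗮ := by
  intro y hy
  rw [Submodule.mem_orthogonal]
  intro v hv
  -- D5′: the line coordinate of `P y` vanishes
  have hD5 : U (P y) = 0 :=
    lpModel_blockProj_eq_zero_of_irreducible_subrep_cm π hu hc νinf νf κ hκ μK χ e hχmul hχone hχinv K' he0 he1 heK hestar P hPdef W hW T hT𝓐 hTP hTB U s hs hU hline hy
  -- `P y ∈ V_P` and `P` is self-adjoint
  have hPV : P y ∈ LinearMap.eqLocus (P : V →ₗ[ℂ] V) LinearMap.id := by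
    subst hPdef
    exact cm_blockProjector_hPV π hu hc νf κ hκ μK χ e hχmul hχone K' he0 he1 heK y
  have hPsa : ⟪P v, y⟫_ℂ = ⟪v, P y⟫_ℂ := by
    subst hPdef
    exact cm_blockProjector_hPsa π hu hc νf κ hκ μK χ e hχinv hestar v y
  rw [← hLnP v hv, hPsa]
  exact hLnU v hv (P y) hPV hD5

end Generic

/-! ## §2 The (N_blk) clause of ★ p862113 at Mok's `U(J₂) = quasiSplit L⁺ L c 2`, arbitrary level datum `(K′, ω)` and line space `Ln` -/

section Print

variable (L : Type) [Field L] [NumberField L] [IsCMField L]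
  (μ : Measure (quasiSplit (↥(maximalRealSubfield L)) L (IsCMField.complexConj L) 2).automorphicQuotient)
  [(quasiSplit (↥(maximalRealSubfield L)) L (IsCMField.complexConj L) 2).IsAutomorphicMeasure μ]
  {K : Type*} [Group K] [TopologicalSpace K] [MeasurableSpace K] [BorelSpace K]
  [MeasurableSpace (UnitaryGroup.arch (↥(maximalRealSubfield L)) L (IsCMField.complexConj L) 2 ((StdForm.antidiagonal 2).over L))] [BorelSpace (UnitaryGroup.arch (↥(maximalRealSubfield L)) L (IsCMField.complexConj L) 2 ((StdForm.antidiagonal 2).over L))]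
  [MeasurableSpace (finAdelic (↥(maximalRealSubfield L)) L (IsCMField.complexConj L) 2 ((StdForm.antidiagonal 2).over L))] [BorelSpace (finAdelic (↥(maximalRealSubfield L)) L (IsCMField.complexConj L) 2 ((StdForm.antidiagonal 2).over L))]
  (νinf : Measure (UnitaryGroup.arch (↥(maximalRealSubfield L)) L (IsCMField.complexConj L) 2 ((StdForm.antidiagonal 2).over L))) [IsFiniteMeasureOnCompacts νinf] [νinf.IsMulLeftInvariant] [νinf.IsInvInvariant] [νinf.IsOpenPosMeasure]
  (νf : Measure (finAdelic (↥(maximalRealSubfield L)) L (IsCMField.complexConj L) 2 ((StdForm.antidiagonal 2).over L))) [IsFiniteMeasureOnCompacts νf] [νf.IsMulLeftInvariant] [νf.IsInvInvariant] [νf.IsOpenPosMeasure]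
  (κ : K →* UnitaryGroup.arch (↥(maximalRealSubfield L)) L (IsCMField.complexConj L) 2 ((StdForm.antidiagonal 2).over L)) (hκ : Continuous κ)
  (μK : Measure K) [IsFiniteMeasureOnCompacts μK] [IsProbabilityMeasure μK] [MeasurableMul K] [μK.IsMulLeftInvariant] [MeasurableInv K] [μK.IsInvInvariant]
  (χ : C_c(K, ℂ)) (e : C_c(finAdelic (↥(maximalRealSubfield L)) L (IsCMField.complexConj L) 2 ((StdForm.antidiagonal 2).over L), ℂ))
  {Ω : Type*} {mΩ : MeasurableSpace Ω} (m : Measure Ω) {E : Type*} [NormedAddCommGroup E] [NormedSpace ℂ E] {J : Type*} [Countable J]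
variable [ENNReal.HolderTriple ∞ 2 2]

/-- **(N_blk) — THE `hN` CLAUSE OF ★ p862113 at an arbitrary level datum `(K′, ω)` and an arbitrary line space `Ln`** (letter shape rule S8-R29 (2)): for Mok's `U(J₂) = quasiSplit L⁺ L c 2`,
any family of unipotent radicals `𝔓`, any `K′ ≤ U(J₂)(𝔸)` with a character `ω`, given the D5′ data∕letters of a block (`(κ, μK, χ; e, K′_f)`, `hPdef`, (L1)–(L3)) and a line space `Ln`
inside `V_P` detected by the line coordinate ((N-iface) `hLnP`, `hLnU`): every topologically irreducible closed `W′ ≤ L²_res(U(J₂), 𝔓)` has `W′ ∩ Iso(K′, ω) ⟂ Ln` — i.e. the binder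
`hN ℓ b` of `residual_le_topologicalClosure_iSup_charLines_of_letters` with `K′ ℓ ↦ K′`, `ω ℓ ↦ ω`, `Ln ℓ b ↦ Ln` (the residual and isotypic hypotheses are not even needed: §1 gives
`W′ ⟂ Ln`). [cite: MoeglinWaldspurger1995, I.2.18, IV.3.12, V.3.13, VI.2] [cite: ReedSimonI1980, Thm. II.3] -/
theorem resH_isotypic_le_orthogonal_of_lineModel
    (𝔓 : (quasiSplit (↥(maximalRealSubfield L)) L (IsCMField.complexConj L) 2).ParabolicUnipotentData)
    (K' : Subgroup (quasiSplit (↥(maximalRealSubfield L)) L (IsCMField.complexConj L) 2).Adelic) (ω : ↥K' →* ℂ)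
    (hχmul : ∀ k l, χ (k * l) = χ k * χ l) (hχone : χ 1 = 1) (hχinv : ∀ k, conj (χ k⁻¹) = χ k)
    (K'f : Subgroup (finAdelic (↥(maximalRealSubfield L)) L (IsCMField.complexConj L) 2 ((StdForm.antidiagonal 2).over L))) (he0 : ∀ x, x ∉ K'f → e x = 0) (he1 : ∫ x, e x ∂νf = 1)
    (heK : ∀ k ∈ K'f, ∀ x, e (k * x) = e x) (hestar : ∀ x, mulStar (⇑e) x = e x)
    (P : (quasiSplit (↥(maximalRealSubfield L)) L (IsCMField.complexConj L) 2).L2 μ →L[ℂ] (quasiSplit (↥(maximalRealSubfield L)) L (IsCMField.complexConj L) 2).L2 μ)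
    (hPdef : P = ((((quasiSplit (↥(maximalRealSubfield L)) L (IsCMField.complexConj L) 2).rightRegular μ).restrict ((archToAdelic (↥(maximalRealSubfield L)) L (IsCMField.complexConj L) 2 ((StdForm.antidiagonal 2).over L)).comp κ)).integratedOperator (((quasiSplit (↥(maximalRealSubfield L)) L (IsCMField.complexConj L) 2).isUnitary_rightRegular μ).restrict _)
          (((quasiSplit (↥(maximalRealSubfield L)) L (IsCMField.complexConj L) 2).isStronglyContinuous_rightRegular_holds μ).restrict _ ((continuous_archToAdelic (↥(maximalRealSubfield L)) L (IsCMField.complexConj L) 2 ((StdForm.antidiagonal 2).over L)).comp hκ)) μK χ ∘L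
        (((quasiSplit (↥(maximalRealSubfield L)) L (IsCMField.complexConj L) 2).rightRegular μ).restrict (finAdelicToAdelic (↥(maximalRealSubfield L)) L (IsCMField.complexConj L) 2 ((StdForm.antidiagonal 2).over L))).integratedOperator (((quasiSplit (↥(maximalRealSubfield L)) L (IsCMField.complexConj L) 2).isUnitary_rightRegular μ).restrict _) (((quasiSplit (↥(maximalRealSubfield L)) L (IsCMField.complexConj L) 2).isStronglyContinuous_rightRegular_holds μ).restrict _ (continuous_finAdelicToAdelic (↥(maximalRealSubfield L)) L (IsCMField.complexConj L) 2 ((StdForm.antidiagonal 2).over L))) νf e))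
    (T : J → (quasiSplit (↥(maximalRealSubfield L)) L (IsCMField.complexConj L) 2).L2 μ →L[ℂ] (quasiSplit (↥(maximalRealSubfield L)) L (IsCMField.complexConj L) 2).L2 μ)
    (hT𝓐 : ∀ j, T j ∈ {A' : (quasiSplit (↥(maximalRealSubfield L)) L (IsCMField.complexConj L) 2).L2 μ →L[ℂ] (quasiSplit (↥(maximalRealSubfield L)) L (IsCMField.complexConj L) 2).L2 μ | ∃ (a : C_c(UnitaryGroup.arch (↥(maximalRealSubfield L)) L (IsCMField.complexConj L) 2 ((StdForm.antidiagonal 2).over L), ℂ)) (b : C_c(finAdelic (↥(maximalRealSubfield L)) L (IsCMField.complexConj L) 2 ((StdForm.antidiagonal 2).over L), ℂ)),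
      A' = (((quasiSplit (↥(maximalRealSubfield L)) L (IsCMField.complexConj L) 2).rightRegular μ).restrict (archToAdelic (↥(maximalRealSubfield L)) L (IsCMField.complexConj L) 2 ((StdForm.antidiagonal 2).over L))).integratedOperator (((quasiSplit (↥(maximalRealSubfield L)) L (IsCMField.complexConj L) 2).isUnitary_rightRegular μ).restrict _) (((quasiSplit (↥(maximalRealSubfield L)) L (IsCMField.complexConj L) 2).isStronglyContinuous_rightRegular_holds μ).restrict _ (continuous_archToAdelic (↥(maximalRealSubfield L)) L (IsCMField.complexConj L) 2 ((StdForm.antidiagonal 2).over L))) νinf a ∘L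
          (((quasiSplit (↥(maximalRealSubfield L)) L (IsCMField.complexConj L) 2).rightRegular μ).restrict (finAdelicToAdelic (↥(maximalRealSubfield L)) L (IsCMField.complexConj L) 2 ((StdForm.antidiagonal 2).over L))).integratedOperator (((quasiSplit (↥(maximalRealSubfield L)) L (IsCMField.complexConj L) 2).isUnitary_rightRegular μ).restrict _) (((quasiSplit (↥(maximalRealSubfield L)) L (IsCMField.complexConj L) 2).isStronglyContinuous_rightRegular_holds μ).restrict _ (continuous_finAdelicToAdelic (↥(maximalRealSubfield L)) L (IsCMField.complexConj L) 2 ((StdForm.antidiagonal 2).over L))) νf b})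
    (hTP : ∀ j, Commute P (T j))
    (hTB : ∀ j, ∀ A' ∈ {A' : (quasiSplit (↥(maximalRealSubfield L)) L (IsCMField.complexConj L) 2).L2 μ →L[ℂ] (quasiSplit (↥(maximalRealSubfield L)) L (IsCMField.complexConj L) 2).L2 μ | ∃ (a : C_c(UnitaryGroup.arch (↥(maximalRealSubfield L)) L (IsCMField.complexConj L) 2 ((StdForm.antidiagonal 2).over L), ℂ)) (b : C_c(finAdelic (↥(maximalRealSubfield L)) L (IsCMField.complexConj L) 2 ((StdForm.antidiagonal 2).over L), ℂ)),
      A' = (((quasiSplit (↥(maximalRealSubfield L)) L (IsCMField.complexConj L) 2).rightRegular μ).restrict (archToAdelic (↥(maximalRealSubfield L)) L (IsCMField.complexConj L) 2 ((StdForm.antidiagonal 2).over L))).integratedOperator (((quasiSplit (↥(maximalRealSubfield L)) L (IsCMField.complexConj L) 2).isUnitary_rightRegular μ).restrict _) (((quasiSplit (↥(maximalRealSubfield L)) L (IsCMField.complexConj L) 2).isStronglyContinuous_rightRegular_holds μ).restrict _ (continuous_archToAdelic (↥(maximalRealSubfield L)) L (IsCMField.complexConj L) 2 ((StdForm.antidiagonal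 2).over L))) νinf a ∘L
          (((quasiSplit (↥(maximalRealSubfield L)) L (IsCMField.complexConj L) 2).rightRegular μ).restrict (finAdelicToAdelic (↥(maximalRealSubfield L)) L (IsCMField.complexConj L) 2 ((StdForm.antidiagonal 2).over L))).integratedOperator (((quasiSplit (↥(maximalRealSubfield L)) L (IsCMField.complexConj L) 2).isUnitary_rightRegular μ).restrict _) (((quasiSplit (↥(maximalRealSubfield L)) L (IsCMField.complexConj L) 2).isStronglyContinuous_rightRegular_holds μ).restrict _ (continuous_finAdelicToAdelic (↥(maximalRealSubfield L)) L (IsCMField.complexConj L) 2 ((StdForm.antidiagonal 2).over L))) νf b},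
      ∀ x ∈ LinearMap.eqLocus (P : (quasiSplit (↥(maximalRealSubfield L)) L (IsCMField.complexConj L) 2).L2 μ →ₗ[ℂ] (quasiSplit (↥(maximalRealSubfield L)) L (IsCMField.complexConj L) 2).L2 μ) LinearMap.id, P (A' (T j x)) = T j (P (A' x)))
    (U : (quasiSplit (↥(maximalRealSubfield L)) L (IsCMField.complexConj L) 2).L2 μ →ₗ[ℂ] Lp E 2 m) (s : J → Ω → ℂ) (hs : ∀ j, MemLp (s j) ∞ m)
    (hU : ∀ j, ∀ v ∈ LinearMap.eqLocus (P : (quasiSplit (↥(maximalRealSubfield L)) L (IsCMField.complexConj L) 2).L2 μ →ₗ[ℂ] (quasiSplit (↥(maximalRealSubfield L)) L (IsCMField.complexConj L) 2).L2 μ) LinearMap.id, U (T j v) = (hs j).toLp (s j) • U v)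
    (hline : ∀ c : J → ℂ, m {x | ∀ j, s j x = c j} = 0)
    (Ln : Submodule ℂ ((quasiSplit (↥(maximalRealSubfield L)) L (IsCMField.complexConj L) 2).L2 μ)) (hLnP : ∀ v ∈ Ln, P v = v)
    (hLnU : ∀ v ∈ Ln, ∀ y ∈ LinearMap.eqLocus (P : (quasiSplit (↥(maximalRealSubfield L)) L (IsCMField.complexConj L) 2).L2 μ →ₗ[ℂ] (quasiSplit (↥(maximalRealSubfield L)) L (IsCMField.complexConj L) 2).L2 μ) LinearMap.id, U y = 0 → ⟪v, y⟫_ℂ = 0) :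
    ∀ W' : ClosedSubrep ((quasiSplit (↥(maximalRealSubfield L)) L (IsCMField.complexConj L) 2).rightRegular μ), W'.toContRep.IsTopIrreducible →
      W' ≤ residualSubspace (quasiSplit (↥(maximalRealSubfield L)) L (IsCMField.complexConj L) 2) μ 𝔓 →
        W'.toSubmodule ⊓ (⨅ k : ↥K', Module.End.eigenspace ((((quasiSplit (↥(maximalRealSubfield L)) L (IsCMField.complexConj L) 2).rightRegular μ) (K'.subtype k) : (quasiSplit (↥(maximalRealSubfield L)) L (IsCMField.complexConj L) 2).L2 μ →L[ℂ] (quasiSplit (↥(maximalRealSubfield L)) L (IsCMField.complexConj L) 2).L2 μ) :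
          (quasiSplit (↥(maximalRealSubfield L)) L (IsCMField.complexConj L) 2).L2 μ →ₗ[ℂ] (quasiSplit (↥(maximalRealSubfield L)) L (IsCMField.complexConj L) 2).L2 μ) (ω k)) ≤ Lnᗮ := by
  intro W' hW' _
  -- `(quasiSplit L⁺ L c 2).Adelic = (cmDatum L 2 ((antidiagonal 2).over L)).Adelic` definitionally (★ `adelic_complexConj`): §1 at `π := R`
  exact inf_le_left.trans
    (subrep_le_orthogonal_of_lineModel_cm (H := (StdForm.antidiagonal 2).over L) ((quasiSplit (↥(maximalRealSubfield L)) L (IsCMField.complexConj L) 2).rightRegular μ)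
      ((quasiSplit (↥(maximalRealSubfield L)) L (IsCMField.complexConj L) 2).isUnitary_rightRegular μ)
      ((quasiSplit (↥(maximalRealSubfield L)) L (IsCMField.complexConj L) 2).isStronglyContinuous_rightRegular_holds μ) νinf νf κ hκ μK χ e m hχmul hχone hχinv K'f he0 he1 heK
      hestar P hPdef T hT𝓐 hTP hTB U s hs hU hline Ln hLnP hLnU W' hW')

end Print

/-! ## §3 (ED. 2) The (N_blk) clause BY NAME at the line space of record `Ln := R90.S8.resHLine L μ U′ K′ ω b` (H4″ DEFS `R90S8ResHBlockDataU2Defs`) -/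

section ByName

open Literature.NumberTheory.GaloisRepresentations

variable (L : Type) [Field L] [NumberField L] [IsCMField L]
  (μ : Measure (quasiSplit (↥(maximalRealSubfield L)) L (IsCMField.complexConj L) 2).automorphicQuotient)
  [(quasiSplit (↥(maximalRealSubfield L)) L (IsCMField.complexConj L) 2).IsAutomorphicMeasure μ]
  {K : Type*} [Group K] [TopologicalSpace K] [MeasurableSpace K] [BorelSpace K]
  [MeasurableSpace (UnitaryGroup.arch (↥(maximalRealSubfield L)) L (IsCMField.complexConj L) 2 ((StdForm.antidiagonal 2).over L))] [BorelSpace (UnitaryGroup.arch (↥(maximalRealSubfield L)) L (IsCMField.complexConj L) 2 ((StdForm.antidiagonal 2).over L))]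
  [MeasurableSpace (finAdelic (↥(maximalRealSubfield L)) L (IsCMField.complexConj L) 2 ((StdForm.antidiagonal 2).over L))] [BorelSpace (finAdelic (↥(maximalRealSubfield L)) L (IsCMField.complexConj L) 2 ((StdForm.antidiagonal 2).over L))]
  (νinf : Measure (UnitaryGroup.arch (↥(maximalRealSubfield L)) L (IsCMField.complexConj L) 2 ((StdForm.antidiagonal 2).over L))) [IsFiniteMeasureOnCompacts νinf] [νinf.IsMulLeftInvariant] [νinf.IsInvInvariant] [νinf.IsOpenPosMeasure]
  (νf : Measure (finAdelic (↥(maximalRealSubfield L)) L (IsCMField.complexConj L) 2 ((StdForm.antidiagonal 2).over L))) [IsFiniteMeasureOnCompacts νf] [νf.IsMulLeftInvariant] [νf.IsInvInvariant] [νf.IsOpenPosMeasure]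
  (κ : K →* UnitaryGroup.arch (↥(maximalRealSubfield L)) L (IsCMField.complexConj L) 2 ((StdForm.antidiagonal 2).over L)) (hκ : Continuous κ)
  (μK : Measure K) [IsFiniteMeasureOnCompacts μK] [IsProbabilityMeasure μK] [MeasurableMul K] [μK.IsMulLeftInvariant] [MeasurableInv K] [μK.IsInvInvariant]
  (χ : C_c(K, ℂ)) (e : C_c(finAdelic (↥(maximalRealSubfield L)) L (IsCMField.complexConj L) 2 ((StdForm.antidiagonal 2).over L), ℂ))
  {A : Type*} [AddCommGroup A] [Module ℂ A]
  {Ω : Type*} {mΩ : MeasurableSpace Ω} (m : Measure Ω) {E : Type*} [NormedAddCommGroup E] [NormedSpace ℂ E] {J : Type*} [Countable J]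
variable [ENNReal.HolderTriple ∞ 2 2]

/-- **(N_blk) BY NAME — the `hN ℓ b` clause of ★ p862113 at the LINE SPACE OF RECORD `resHLine L μ U′ K′ ω b`** (H4″ DEFS: `resHBlock` = the closed `(K′,ω,χ)`-block `Sc`,
`resHAtom U′ = Sc ⊓ ker (snd ∘ U′)`, `resHLine U′ = Sc ⊓ (resHAtom U′)ᗮ`, for the block-model coordinate `U′ : L² →ₗ[ℂ] A × L²(Ω; E)` of D5′ bridge currency (★ `hD5_of_letters`)).  §2 at
`U := snd ∘ U′`, with the two interface letters DISCHARGED by the read-backs of the defs: `hLnP` from `resHLine ≤ resHBlock ≤ V_P` (the visible letter `hScP : resHBlock ≤ V_P` — the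
block's generators are `(K′,ω)`-isotypic; payer at the Σ-family: ★ `cm_blockProjector_eq_self_iff` + `isClosed_eqLocus_id`) and `hLnU` from ★ `inner_eq_zero_of_mem_resHLine` at
`y := P_{Sc} x` (orthogonal projection onto the closed block) together with the visible letter `hUker : Scᗮ ≤ ker U′` («`U′ = U_SD ∘ P_{Sc}` factors through the block», by construction of
the model — payer: whoever fixes `U′`), which gives `U′ (P_{Sc} x) = U′ x`.  Remaining visible bill: D5′'s `(κ, μK, χ; e, K′_f)`, `hPdef`, (L1) `T hT𝓐 hTP hTB`, (L2) `U′ s hs hU`, (L3)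
`hline`, and `hScP`, `hUker`. [cite: MoeglinWaldspurger1995, I.2.18, IV.3.12, V.3.13, VI.2] [cite: ReedSimonI1980, Thm. II.3] -/
theorem resH_isotypic_le_orthogonal_lines
    (𝔓 : (quasiSplit (↥(maximalRealSubfield L)) L (IsCMField.complexConj L) 2).ParabolicUnipotentData)
    (K' : Subgroup (quasiSplit (↥(maximalRealSubfield L)) L (IsCMField.complexConj L) 2).Adelic) (ω : ↥K' →* ℂ)
    (b : HeckeCharacter L)
    (hχmul : ∀ k l, χ (k * l) = χ k * χ l) (hχone : χ 1 = 1) (hχinv : ∀ k, conj (χ k⁻¹) = χ k)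
    (K'f : Subgroup (finAdelic (↥(maximalRealSubfield L)) L (IsCMField.complexConj L) 2 ((StdForm.antidiagonal 2).over L))) (he0 : ∀ x, x ∉ K'f → e x = 0) (he1 : ∫ x, e x ∂νf = 1)
    (heK : ∀ k ∈ K'f, ∀ x, e (k * x) = e x) (hestar : ∀ x, mulStar (⇑e) x = e x)
    (P : (quasiSplit (↥(maximalRealSubfield L)) L (IsCMField.complexConj L) 2).L2 μ →L[ℂ] (quasiSplit (↥(maximalRealSubfield L)) L (IsCMField.complexConj L) 2).L2 μ)
    (hPdef : P = ((((quasiSplit (↥(maximalRealSubfield L)) L (IsCMField.complexConj L) 2).rightRegular μ).restrict ((archToAdelic (↥(maximalRealSubfield L)) L (IsCMField.complexConj L) 2 ((StdForm.antidiagonal 2).over L)).comp κ)).integratedOperator (((quasiSplit (↥(maximalRealSubfield L)) L (IsCMField.complexConj L) 2).isUnitary_rightRegular μ).restrict _)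
          (((quasiSplit (↥(maximalRealSubfield L)) L (IsCMField.complexConj L) 2).isStronglyContinuous_rightRegular_holds μ).restrict _ ((continuous_archToAdelic (↥(maximalRealSubfield L)) L (IsCMField.complexConj L) 2 ((StdForm.antidiagonal 2).over L)).comp hκ)) μK χ ∘L
        (((quasiSplit (↥(maximalRealSubfield L)) L (IsCMField.complexConj L) 2).rightRegular μ).restrict (finAdelicToAdelic (↥(maximalRealSubfield L)) L (IsCMField.complexConj L) 2 ((StdForm.antidiagonal 2).over L))).integratedOperator (((quasiSplit (↥(maximalRealSubfield L)) L (IsCMField.complexConj L) 2).isUnitary_rightRegular μ).restrict _) (((quasiSplit (↥(maximalRealSubfield L)) L (IsCMField.complexConj L) 2).isStronglyContinuous_rightRegular_holds μ).restrict _ (continuous_finAdelicToAdelic (↥(maximalRealSubfield L)) L (IsCMField.complexConj L) 2 ((StdForm.antidiagonal 2).over L))) νf e))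
    (T : J → (quasiSplit (↥(maximalRealSubfield L)) L (IsCMField.complexConj L) 2).L2 μ →L[ℂ] (quasiSplit (↥(maximalRealSubfield L)) L (IsCMField.complexConj L) 2).L2 μ)
    (hT𝓐 : ∀ j, T j ∈ {A' : (quasiSplit (↥(maximalRealSubfield L)) L (IsCMField.complexConj L) 2).L2 μ →L[ℂ] (quasiSplit (↥(maximalRealSubfield L)) L (IsCMField.complexConj L) 2).L2 μ | ∃ (a : C_c(UnitaryGroup.arch (↥(maximalRealSubfield L)) L (IsCMField.complexConj L) 2 ((StdForm.antidiagonal 2).over L), ℂ)) (b : C_c(finAdelic (↥(maximalRealSubfield L)) L (IsCMField.complexConj L) 2 ((StdForm.antidiagonal 2).over L), ℂ)),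
      A' = (((quasiSplit (↥(maximalRealSubfield L)) L (IsCMField.complexConj L) 2).rightRegular μ).restrict (archToAdelic (↥(maximalRealSubfield L)) L (IsCMField.complexConj L) 2 ((StdForm.antidiagonal 2).over L))).integratedOperator (((quasiSplit (↥(maximalRealSubfield L)) L (IsCMField.complexConj L) 2).isUnitary_rightRegular μ).restrict _) (((quasiSplit (↥(maximalRealSubfield L)) L (IsCMField.complexConj L) 2).isStronglyContinuous_rightRegular_holds μ).restrict _ (continuous_archToAdelic (↥(maximalRealSubfield L)) L (IsCMField.complexConj L) 2 ((StdForm.antidiagonal 2).over L))) νinf a ∘L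
          (((quasiSplit (↥(maximalRealSubfield L)) L (IsCMField.complexConj L) 2).rightRegular μ).restrict (finAdelicToAdelic (↥(maximalRealSubfield L)) L (IsCMField.complexConj L) 2 ((StdForm.antidiagonal 2).over L))).integratedOperator (((quasiSplit (↥(maximalRealSubfield L)) L (IsCMField.complexConj L) 2).isUnitary_rightRegular μ).restrict _) (((quasiSplit (↥(maximalRealSubfield L)) L (IsCMField.complexConj L) 2).isStronglyContinuous_rightRegular_holds μ).restrict _ (continuous_finAdelicToAdelic (↥(maximalRealSubfield L)) L (IsCMField.complexConj L) 2 ((StdForm.antidiagonal 2).over L))) νf b})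
    (hTP : ∀ j, Commute P (T j))
    (hTB : ∀ j, ∀ A' ∈ {A' : (quasiSplit (↥(maximalRealSubfield L)) L (IsCMField.complexConj L) 2).L2 μ →L[ℂ] (quasiSplit (↥(maximalRealSubfield L)) L (IsCMField.complexConj L) 2).L2 μ | ∃ (a : C_c(UnitaryGroup.arch (↥(maximalRealSubfield L)) L (IsCMField.complexConj L) 2 ((StdForm.antidiagonal 2).over L), ℂ)) (b : C_c(finAdelic (↥(maximalRealSubfield L)) L (IsCMField.complexConj L) 2 ((StdForm.antidiagonal 2).over L), ℂ)),
      A' = (((quasiSplit (↥(maximalRealSubfield L)) L (IsCMField.complexConj L) 2).rightRegular μ).restrict (archToAdelic (↥(maximalRealSubfield L)) L (IsCMField.complexConj L) 2 ((StdForm.antidiagonal 2).over L))).integratedOperator (((quasiSplit (↥(maximalRealSubfield L)) L (IsCMField.complexConj L) 2).isUnitary_rightRegular μ).restrict _) (((quasiSplit (↥(maximalRealSubfield L)) L (IsCMField.complexConj L) 2).isStronglyContinuous_rightRegular_holds μ).restrict _ (continuous_archToAdelic (↥(maximalRealSubfield L)) L (IsCMField.complexConj L) 2 ((StdForm.antidiagonal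 2).over L))) νinf a ∘L
          (((quasiSplit (↥(maximalRealSubfield L)) L (IsCMField.complexConj L) 2).rightRegular μ).restrict (finAdelicToAdelic (↥(maximalRealSubfield L)) L (IsCMField.complexConj L) 2 ((StdForm.antidiagonal 2).over L))).integratedOperator (((quasiSplit (↥(maximalRealSubfield L)) L (IsCMField.complexConj L) 2).isUnitary_rightRegular μ).restrict _) (((quasiSplit (↥(maximalRealSubfield L)) L (IsCMField.complexConj L) 2).isStronglyContinuous_rightRegular_holds μ).restrict _ (continuous_finAdelicToAdelic (↥(maximalRealSubfield L)) L (IsCMField.complexConj L) 2 ((StdForm.antidiagonal 2).over L))) νf b},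
      ∀ x ∈ LinearMap.eqLocus (P : (quasiSplit (↥(maximalRealSubfield L)) L (IsCMField.complexConj L) 2).L2 μ →ₗ[ℂ] (quasiSplit (↥(maximalRealSubfield L)) L (IsCMField.complexConj L) 2).L2 μ) LinearMap.id, P (A' (T j x)) = T j (P (A' x)))
    (U' : (quasiSplit (↥(maximalRealSubfield L)) L (IsCMField.complexConj L) 2).L2 μ →ₗ[ℂ] A × Lp E 2 m) (s : J → Ω → ℂ) (hs : ∀ j, MemLp (s j) ∞ m)
    (hU : ∀ j, ∀ v ∈ LinearMap.eqLocus (P : (quasiSplit (↥(maximalRealSubfield L)) L (IsCMField.complexConj L) 2).L2 μ →ₗ[ℂ] (quasiSplit (↥(maximalRealSubfield L)) L (IsCMField.complexConj L) 2).L2 μ) LinearMap.id, (U' (T j v)).2 = ((hs j).toLp (s j) • (U' v).2 : Lp E 2 m))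
    (hline : ∀ c : J → ℂ, m {x | ∀ j, s j x = c j} = 0)
    (hScP : resHBlock L μ K' ω b ≤ LinearMap.eqLocus (P : (quasiSplit (↥(maximalRealSubfield L)) L (IsCMField.complexConj L) 2).L2 μ →ₗ[ℂ] (quasiSplit (↥(maximalRealSubfield L)) L (IsCMField.complexConj L) 2).L2 μ) LinearMap.id)
    (hUker : (resHBlock L μ K' ω b)ᗮ ≤ LinearMap.ker U') :
    ∀ W' : ClosedSubrep ((quasiSplit (↥(maximalRealSubfield L)) L (IsCMField.complexConj L) 2).rightRegular μ), W'.toContRep.IsTopIrreducible →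
      W' ≤ residualSubspace (quasiSplit (↥(maximalRealSubfield L)) L (IsCMField.complexConj L) 2) μ 𝔓 →
        W'.toSubmodule ⊓ (⨅ k : ↥K', Module.End.eigenspace ((((quasiSplit (↥(maximalRealSubfield L)) L (IsCMField.complexConj L) 2).rightRegular μ) (K'.subtype k) : (quasiSplit (↥(maximalRealSubfield L)) L (IsCMField.complexConj L) 2).L2 μ →L[ℂ] (quasiSplit (↥(maximalRealSubfield L)) L (IsCMField.complexConj L) 2).L2 μ) :
          (quasiSplit (↥(maximalRealSubfield L)) L (IsCMField.complexConj L) 2).L2 μ →ₗ[ℂ] (quasiSplit (↥(maximalRealSubfield L)) L (IsCMField.complexConj L) 2).L2 μ) (ω k)) ≤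
          (resHLine L μ U' K' ω b)ᗮ := by
  -- the closed block is complete, so it has an orthogonal projection `P_{Sc}`
  haveI : CompleteSpace (resHBlock L μ K' ω b) := (isClosed_resHBlock L μ K' ω b).completeSpace_coe
  refine resH_isotypic_le_orthogonal_of_lineModel L μ νinf νf κ hκ μK χ e m 𝔓 K' ω hχmul hχone hχinv K'f he0 he1 heK hestar P hPdef T hT𝓐 hTP hTB
    ((LinearMap.snd ℂ A (Lp E 2 m)).comp U') s hs (fun j v hv => ?_) hline (resHLine L μ U' K' ω b) (fun v hv => ?_) (fun v hv y _ hUy => ?_)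
  · -- `hU` on the line coordinate
    simpa only [LinearMap.comp_apply, LinearMap.snd_apply] using hU j v hv
  · -- `hLnP`: `Ln ≤ Sc ≤ V_P`
    exact apply_eq_of_mem_eqLocus P v (hScP (resHLine_le_resHBlock L μ U' K' ω b hv))
  · -- `hLnU`: ★ `inner_eq_zero_of_mem_resHLine` at `y₀ := P_{Sc} y`, with `U′ y₀ = U′ y` from `hUker`
    refine inner_eq_zero_of_mem_resHLine L μ U' K' ω b hv y
      ⟨(resHBlock L μ K' ω b).starProjection y, Submodule.starProjection_apply_mem _ y, Submodule.sub_starProjection_mem_orthogonal y, ?_⟩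
    have hker : U' (y - (resHBlock L μ K' ω b).starProjection y) = 0 :=
      LinearMap.mem_ker.1 (hUker (Submodule.sub_starProjection_mem_orthogonal y))
    have hEq : U' ((resHBlock L μ K' ω b).starProjection y) = U' y := by
      rw [map_sub, sub_eq_zero] at hker
      exact hker.symm
    rw [hEq]
    simpa only [LinearMap.comp_apply, LinearMap.snd_apply] using hUy

end ByName

end Summit.HodgeConjecture.HodgeConjecture.R90.S8

end
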